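import Summits.ResolutionOfSingularities.ResolutionOfSingularities.Theorems.FrobeniusClosingPatchingRelPerfectMonomialPolyhedraGameFree
import HarnessLib

/-!
# Crux `PatchingRelPerfect` (stmt-ResolutionOfSingularities-16161), chain w52 — TargetsF3 (m) «M2-strong»,
# COMBINATORIAL HALF, Route F file F1: CHARTS of a move (what a blow-up does to one stratum)

[OURS · L1 W5.2 · background line; res-L1-w52-stub-4 g3 ROUTE-F memo §0 (G1), kernel form; fact-free;
nothing here is a statement of the manuscript under review]

After the move `move s J e c` (blow up the stratum `E_J`, exceptional index `e`, bookkeeping constant `c`) the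
strata are the old strata not containing `J` (unchanged data) and the CHARTS `insert e T₀` (`J ⊄ T₀`,
`T₀ ∪ J` an old stratum), whose restricted exponent vectors are the images of those of the PARENT stratum
`T₀ ∪ J` under the monotone map `x ↦ (x|_{T₀}, |x_J| − c)`.  Consequences typed here:

* `principalAt_chart` — **a principal parent has principal charts**; `exists_parent_of_not_principalAt` — every
  non-principal stratum of the moved state descends from a non-principal old stratum containing its non-
  exceptional indices (so no measure supported on non-principal strata can grow new support);
* `ComparableOn` (two generators are comparable on an index set) and `comparableOn_chart` /
  `comparableOn_move_of_forall` — **comparability on every stratum persists** under every move;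
* `card_inter_le_of_chart` — the number of indices of a chart inside a fixed set `O ∌ e` is at most that of its
  parent (the level `ν` of ROUTE-F never rises).

## References

* J. Kollár, *Lectures on Resolution of Singularities* (2007), (3.111) Step 3. [Kollar2007]
-/

-- `Summit.<Summit>.<Sub>.Theorems` with `Sub = Summit` (single-conjunct summit, D-0017)
set_option linter.dupNamespace false

namespace Summit.ResolutionOfSingularities.ResolutionOfSingularities.Theorems

namespace PolyhedraGame

open Finset

/-! ## The chart map on exponent vectors -/

section Chart

variable {s : State} {J T₀ : Finset ℕ} {e c : ℕ}

/-- [OURS] The weight is monotone in the exponent vector on the index set. -/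
theorem weight_le_weight_of_le {J : Finset ℕ} {α β : ℕ →₀ ℕ} (h : ∀ j ∈ J, α j ≤ β j) :
    weight J α ≤ weight J β :=
  Finset.sum_le_sum h

/-- [OURS] **The chart map is monotone**: if `α ≤ β` on the parent `T₀ ∪ J` then `moveExp α ≤ moveExp β` on the
chart `insert e T₀` (for `e` outside both supports and outside `T₀`). -/
theorem moveExp_le_of_le_on_parent {α β : ℕ →₀ ℕ} (heα : e ∉ α.support) (heβ : e ∉ β.support)
    (heT₀ : e ∉ T₀) (h : ∀ i ∈ T₀ ∪ J, α i ≤ β i) :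
    ∀ i ∈ insert e T₀, moveExp J e c α i ≤ moveExp J e c β i := by
  intro i hi
  rcases Finset.mem_insert.mp hi with rfl | hi
  · rw [moveExp_apply_self α heα, moveExp_apply_self β heβ]
    exact Nat.sub_le_sub_right (weight_le_weight_of_le fun j hj => h j (Finset.mem_union_right _ hj)) c
  · have hie : i ≠ e := fun h' => heT₀ (h' ▸ hi)
    rw [moveExp_apply_of_ne α hie, moveExp_apply_of_ne β hie]
    exact h i (Finset.mem_union_left _ hi)

/-- [OURS] **A principal parent has principal charts**: if the state is principal at the old stratum `T₀ ∪ J`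
then the moved state is principal at the chart `insert e T₀` (fresh `e`). -/
theorem principalAt_chart (hs : s.WF) (he : e ∉ s.B) (heT₀ : e ∉ T₀)
    (h : PrincipalAt s (T₀ ∪ J)) : PrincipalAt (move s J e c) (insert e T₀) := by
  obtain ⟨α₀, hα₀, hmin⟩ := h
  refine ⟨moveExp J e c α₀, Finset.mem_image_of_mem _ hα₀, fun β hβ => ?_⟩
  obtain ⟨α, hα, rfl⟩ := Finset.mem_image.mp hβ
  exact moveExp_le_of_le_on_parent (fun h' => he (hs.support_subset α₀ hα₀ h'))
    (fun h' => he (hs.support_subset α hα h')) heT₀ (hmin α hα)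

/-- [OURS] **Every non-principal stratum of the moved state has a non-principal parent**: an old non-principal
stratum containing all its indices other than `e` (itself if it avoids `e`, else `T₀ ∪ J`). -/
theorem exists_parent_of_not_principalAt (hs : s.WF) (he : e ∉ s.B) {T' : Finset ℕ}
    (hT' : T' ∈ (move s J e c).Str) (hnp : ¬ PrincipalAt (move s J e c) T') :
    ∃ T ∈ s.Str, ¬ PrincipalAt s T ∧ T'.erase e ⊆ T := by
  by_cases heT' : e ∈ T'
  · rcases mem_moveStrata_iff.mp hT' with ⟨hold, -⟩ | ⟨T₀, hT₀, -, hTJ, rfl⟩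
    · exact absurd (hs.str_subset T' hold heT') he
    · have heT₀ : e ∉ T₀ := fun h => he (hs.str_subset T₀ hT₀ h)
      refine ⟨T₀ ∪ J, hTJ, fun hp => hnp (principalAt_chart hs he heT₀ hp), ?_⟩
      rw [Finset.erase_insert heT₀]
      exact Finset.subset_union_left
  · obtain ⟨hold, -⟩ := mem_str_of_mem_move_str_of_not_mem hT' heT'
    exact ⟨T', hold, fun hp => hnp ((principalAt_move_iff heT').mpr hp), Finset.erase_subset _ _⟩

/-- [OURS] **Levels never rise**: for a fixed index set `O` not containing the exceptional index, every
non-principal stratum of the moved state meets `O` in at most as many indices as some non-principal old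
stratum. -/
theorem card_inter_le_of_not_principalAt (hs : s.WF) (he : e ∉ s.B) {O : Finset ℕ} (heO : e ∉ O)
    {T' : Finset ℕ} (hT' : T' ∈ (move s J e c).Str) (hnp : ¬ PrincipalAt (move s J e c) T') :
    ∃ T ∈ s.Str, ¬ PrincipalAt s T ∧ T' ∩ O ⊆ T ∩ O := by
  obtain ⟨T, hT, hnpT, hsub⟩ := exists_parent_of_not_principalAt hs he hT' hnp
  refine ⟨T, hT, hnpT, fun i hi => ?_⟩
  rw [Finset.mem_inter] at hi ⊢
  have hie : i ≠ e := fun h => heO (h ▸ hi.2)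
  exact ⟨hsub (Finset.mem_erase.mpr ⟨hie, hi.1⟩), hi.2⟩

end Chart

/-! ## Comparability of two generators on an index set, and its persistence -/

section Comparable

/-- [OURS] Two exponent vectors are comparable on the index set `T` (one is `≤` the other there). -/
def ComparableOn (T : Finset ℕ) (α β : ℕ →₀ ℕ) : Prop :=
  (∀ i ∈ T, α i ≤ β i) ∨ (∀ i ∈ T, β i ≤ α i)

/-- [OURS] Comparability is symmetric. -/
theorem ComparableOn.symm {T : Finset ℕ} {α β : ℕ →₀ ℕ} (h : ComparableOn T α β) : ComparableOn T β α :=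
  Or.symm h

/-- [OURS] Comparability restricts to subsets. -/
theorem ComparableOn.mono {T T' : Finset ℕ} {α β : ℕ →₀ ℕ} (h : ComparableOn T' α β) (hT : T ⊆ T') :
    ComparableOn T α β :=
  h.imp (fun h i hi => h i (hT hi)) (fun h i hi => h i (hT hi))

/-- [OURS] Two vectors are NOT comparable on `T` iff `T` contains a BAD index pair for them: indices `k, l`
with `α k > β k` and `α l < β l`. -/
theorem not_comparableOn_iff {T : Finset ℕ} {α β : ℕ →₀ ℕ} :
    ¬ ComparableOn T α β ↔ ∃ k ∈ T, ∃ l ∈ T, β k < α k ∧ α l < β l := by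
  simp only [ComparableOn, not_or, not_forall, not_le, exists_prop]
  constructor
  · rintro ⟨⟨k, hk, hk'⟩, ⟨l, hl, hl'⟩⟩; exact ⟨k, hk, l, hl, hk', hl'⟩
  · rintro ⟨k, hk, l, hl, hk', hl'⟩; exact ⟨⟨k, hk, hk'⟩, ⟨l, hl, hl'⟩⟩

variable {s : State} {J T₀ : Finset ℕ} {e c : ℕ}

/-- [OURS] **Comparability passes to charts**: comparable on the parent `T₀ ∪ J` ⇒ the moved vectors are
comparable on the chart `insert e T₀`. -/
theorem comparableOn_chart {α β : ℕ →₀ ℕ} (heα : e ∉ α.support) (heβ : e ∉ β.support) (heT₀ : e ∉ T₀)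
    (h : ComparableOn (T₀ ∪ J) α β) :
    ComparableOn (insert e T₀) (moveExp J e c α) (moveExp J e c β) :=
  h.imp (moveExp_le_of_le_on_parent heα heβ heT₀) (moveExp_le_of_le_on_parent heβ heα heT₀)

/-- [OURS] At index sets avoiding `e` the moved vectors compare as the old ones. -/
theorem comparableOn_moveExp_iff {T : Finset ℕ} (heT : e ∉ T) (α β : ℕ →₀ ℕ) :
    ComparableOn T (moveExp J e c α) (moveExp J e c β) ↔ ComparableOn T α β := by
  have key : ∀ γ : ℕ →₀ ℕ, ∀ i ∈ T, moveExp J e c γ i = γ i := fun γ i hi =>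
    moveExp_apply_of_ne γ (fun h => heT (h ▸ hi))
  unfold ComparableOn
  constructor <;> rintro (h | h)
  · exact Or.inl fun i hi => by rw [← key α i hi, ← key β i hi]; exact h i hi
  · exact Or.inr fun i hi => by rw [← key α i hi, ← key β i hi]; exact h i hi
  · exact Or.inl fun i hi => by rw [key α i hi, key β i hi]; exact h i hi
  · exact Or.inr fun i hi => by rw [key α i hi, key β i hi]; exact h i hi

/-- [OURS] **Comparability on every stratum persists under a move**: if `α, β` are comparable on every old
stratum then `moveExp α, moveExp β` are comparable on every stratum of the moved state. -/
theorem comparableOn_move_of_forall (hs : s.WF) (he : e ∉ s.B) {α β : ℕ →₀ ℕ} (hα : α ∈ s.A) (hβ : β ∈ s.A)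
    (h : ∀ T ∈ s.Str, ComparableOn T α β) :
    ∀ T' ∈ (move s J e c).Str, ComparableOn T' (moveExp J e c α) (moveExp J e c β) := by
  intro T' hT'
  have heα : e ∉ α.support := fun h' => he (hs.support_subset α hα h')
  have heβ : e ∉ β.support := fun h' => he (hs.support_subset β hβ h')
  rcases mem_moveStrata_iff.mp hT' with ⟨hold, -⟩ | ⟨T₀, hT₀, -, hTJ, rfl⟩
  · have heT' : e ∉ T' := fun h' => he (hs.str_subset T' hold h')
    exact (comparableOn_moveExp_iff heT' α β).mpr (h T' hold)
  · have heT₀ : e ∉ T₀ := fun h' => he (hs.str_subset T₀ hT₀ h')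
    exact comparableOn_chart heα heβ heT₀ (h _ hTJ)

/-- [OURS] **Pairwise comparability at a stratum gives principality there** (a finite non-empty totally
preordered set has a least element). -/
theorem principalAt_of_forall_comparableOn (hs : s.WF) {T : Finset ℕ}
    (h : ∀ α ∈ s.A, ∀ β ∈ s.A, ComparableOn T α β) : PrincipalAt s T := by
  classical
  -- induction on a finset of generators: every non-empty sub-finset has a least element on `T`
  suffices key : ∀ A' : Finset (ℕ →₀ ℕ), A' ⊆ s.A → A'.Nonempty →
      ∃ α₀ ∈ A', ∀ α ∈ A', ∀ i ∈ T, α₀ i ≤ α i by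
    obtain ⟨α₀, hα₀, hmin⟩ := key s.A le_rfl hs.nonempty
    exact ⟨α₀, hα₀, hmin⟩
  intro A'
  induction A' using Finset.induction_on with
  | empty => intro _ h; exact absurd h Finset.not_nonempty_empty
  | @insert γ A' hγ ih =>
    intro hsub _
    by_cases hA' : A'.Nonempty
    · obtain ⟨α₀, hα₀, hmin⟩ := ih ((Finset.subset_insert _ _).trans hsub) hA'
      rcases h γ (hsub (Finset.mem_insert_self _ _)) α₀ (hsub (Finset.mem_insert_of_mem hα₀)) with hle | hle
      · refine ⟨γ, Finset.mem_insert_self _ _, fun α hα i hi => ?_⟩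
        rcases Finset.mem_insert.mp hα with rfl | hα
        · exact le_rfl
        · exact (hle i hi).trans (hmin α hα i hi)
      · refine ⟨α₀, Finset.mem_insert_of_mem hα₀, fun α hα i hi => ?_⟩
        rcases Finset.mem_insert.mp hα with rfl | hα
        · exact hle i hi
        · exact hmin α hα i hi
    · rw [Finset.not_nonempty_iff_eq_empty] at hA'
      subst hA'
      refine ⟨γ, Finset.mem_insert_self _ _, fun α hα i hi => ?_⟩
      rw [Finset.insert_empty, Finset.mem_singleton] at hα
      rw [hα]

end Comparable

end PolyhedraGame

end Summit.ResolutionOfSingularities.ResolutionOfSingularities.Theorems
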